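import Literature.Geometry.Symplectic.SphereCRFamily
import HarnessLib

/-!
# Stability of the bordered isomorphism along the implicit-function family

Layer B7 (step 0) of the analytic core of the Hofer–Lizan–Sikorav local foliation theorem
(Wendl 2018, Thm. 2.46; lead of crux `WitnessCharge`, summit `SmoothPoincare4`). Along the family
`γ` of `SphereCRFamily.exists_family` the partial derivative in `y` of the implicit-function map
`G` stays a linear homeomorphism for `a` near `0`:
`exists_pos_forall_isEquiv_fderiv` — there is `ε' ∈ (0, ε]` such that for every `‖a‖ < ε'` the
operator `(fderiv ℝ G (a, γ a)) ∘ inr : SecPair k r →L Z` is (the coercion of) a continuous linear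
equivalence. Proof: `G` is `C^∞` on the open set `ℂ × {small}`, so `p ↦ fderiv ℝ G p` is
continuous there; `a ↦ (a, γ a)` is continuous; at `a = 0` the operator is `linEquiv`; and the
invertible operators form an open set (`ContinuousLinearEquiv.isOpen`).

## References

* C. Wendl, *Holomorphic Curves in Low Dimensions*, LNM 2216 (2018), §2.3, Thm. 2.46. [Wendl2018]
-/

noncomputable section

open Set Filter Metric Function Complex
open scoped Topology NNReal ContDiff
open Literature.Analysis.FunctionSpaces Literature.Analysis.Complex.RiemannSphere
open Literature.Analysis.Complex Literature.Analysis.Calculus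

namespace Literature.Geometry.Symplectic

namespace SphereCR

namespace SphereACData

/-- The codomain of the implicit-function map: `(𝓗T' × 𝓗N') × ((ℂ × ℂ × ℂ) × ℂ)`. [folklore] -/
abbrev Zsp (k : ℕ) (r : ℝ≥0) : Type :=
  (holderSections ℂ (dbarClutch (fun w : ℂ => -w ^ 2)) k r ×
    holderSections ℂ (dbarClutch (1 : ℂ → ℂ)) k r) × ((ℂ × ℂ × ℂ) × ℂ)

variable (𝒥 : SphereACData) {r : ℝ≥0} {k : ℕ}

/-- `p ↦ fderiv ℝ G p` is continuous on `ℂ × {small}`. [folklore] -/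
theorem continuousOn_fderiv_Gmap (hr : r ≤ 1) (k : ℕ) :
    ContinuousOn (fun p : ℂ × SecPair k r => fderiv ℝ (𝒥.Gmap hr k) p)
      (univ ×ˢ {y : SecPair k r | Small hr k y}) :=
  (𝒥.contDiffOn_Gmap hr k).continuousOn_fderiv_of_isOpen (isOpen_univ.prod (isOpen_small hr k))
    (by simp)

/-- **Stability of the bordered isomorphism along the family**: for a family `γ` continuous on
`ball 0 ε` with small values, `γ 0 = 0`, the partial derivative
`(fderiv ℝ G (a, γ a)) ∘ inr` is a continuous linear EQUIVALENCE for all `‖a‖ < ε'`, some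
`ε' ∈ (0, ε]` (`k ≥ 1`). [cite: Wendl2018, Thm. 2.46] -/
theorem exists_pos_forall_isEquiv_fderiv (hr0 : 0 < r) (hr1 : r < 1) (hk : 1 ≤ k) {ε : ℝ}
    (hε : 0 < ε) (γ : ℂ → SecPair k r) (hγc : ContinuousOn γ (ball 0 ε)) (hγ0 : γ 0 = 0)
    (hsmall : ∀ a ∈ ball (0 : ℂ) ε, Small hr1.le k (γ a)) :
    ∃ ε' > (0 : ℝ), ε' ≤ ε ∧ ∀ a ∈ ball (0 : ℂ) ε',
      ∃ e : SecPair k r ≃L[ℝ] Zsp k r,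
        (e : SecPair k r →L[ℝ] Zsp k r) =
          (fderiv ℝ (𝒥.Gmap hr1.le k) (a, γ a)).comp (ContinuousLinearMap.inr ℝ ℂ (SecPair k r)) := by
  -- the operator-valued map `a ↦ D_y G (a, γ a)`
  set F : ℂ → (SecPair k r →L[ℝ] Zsp k r) := fun a =>
    (fderiv ℝ (𝒥.Gmap hr1.le k) (a, γ a)).comp (ContinuousLinearMap.inr ℝ ℂ (SecPair k r)) with hF
  have hγin : MapsTo (fun a : ℂ => ((a, γ a) : ℂ × SecPair k r)) (ball 0 ε)
      (univ ×ˢ {y : SecPair k r | Small hr1.le k y}) := fun a ha => ⟨mem_univ _, hsmall a ha⟩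
  have hpair : ContinuousOn (fun a : ℂ => ((a, γ a) : ℂ × SecPair k r)) (ball 0 ε) :=
    continuousOn_id.prodMk hγc
  have hFc : ContinuousOn F (ball 0 ε) := by
    have h1 : ContinuousOn (fun a : ℂ => fderiv ℝ (𝒥.Gmap hr1.le k) (a, γ a)) (ball 0 ε) :=
      (𝒥.continuousOn_fderiv_Gmap hr1.le k).comp hpair hγin
    exact ((ContinuousLinearMap.precomp _ (ContinuousLinearMap.inr ℝ ℂ (SecPair k r))).continuous
      ).comp_continuousOn h1
  have hF0 : F 0 = (𝒥.linEquiv hr0 hr1 hk : SecPair k r →L[ℝ] Zsp k r) := by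
    rw [hF]
    simp only [hγ0]
    exact 𝒥.fderiv_Gmap_comp_inr hr0 hr1 hk
  -- the invertible operators are open; pull back
  have hopen := ContinuousLinearEquiv.isOpen (𝕜 := ℝ) (E := SecPair k r) (F := Zsp k r)
  have hmem0 : F 0 ∈ range ((↑) : (SecPair k r ≃L[ℝ] Zsp k r) → SecPair k r →L[ℝ] Zsp k r) :=
    ⟨𝒥.linEquiv hr0 hr1 hk, hF0.symm⟩
  have hFa : ContinuousAt F 0 := hFc.continuousAt (ball_mem_nhds 0 hε)
  obtain ⟨ε₁, hε₁, hball⟩ := Metric.eventually_nhds_iff_ball.1 (hFa.preimage_mem_nhds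
    (hopen.mem_nhds hmem0))
  refine ⟨min ε ε₁, lt_min hε hε₁, min_le_left _ _, fun a ha => ?_⟩
  have ha₁ : a ∈ ball (0 : ℂ) ε₁ := ball_subset_ball (min_le_right _ _) ha
  obtain ⟨e, he⟩ := hball a ha₁
  exact ⟨e, he⟩

end SphereACData

end SphereCR

end Literature.Geometry.Symplectic

end
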